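/-
Copyright: public-audit package `pub-balaban` (b2b-balaban), seat pv09-g4. Released under Apache 2.0 like Mathlib.
-/
import Literature.MathematicalPhysics.QuantumFieldTheory.Balaban1983to89.B6Lemma24Assembly

/-!
# B6, Lemma 2.4 (2.128) with the constant κ₀ in the PRINTED SHAPE: Q₁ as printed, (2.121) as printed, sums over all
bonds / all plaquettes

Source under audit: T. Bałaban, *Propagators and renormalization transformations for lattice gauge theories.
II*, Commun. Math. Phys. **96** (1984) 223–250 [B6], Lemma 2.4, p. 245; notation from *… I*, Commun. Math. Phys.
**95** (1984) 17–40 [B5], (1.7), (1.8), (1.11), (1.18), pp. 18–20.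

## Texts (verbatim)

* [B6] Lemma 2.4, p. 245: *"Let a set Λ ⊂ Z^d be a sum of blocks, Λ = B(Λ′). We denote by Λ also a set of bonds b
  such that at least one of the end-points b₋, b₊ belongs to Λ. Let B be a configuration defined on Λ and satisfying
  the condition (2.121): B(Γ_{y,x}) = 0 for x ∈ B(y), y ∈ Λ′. We put B = 0 outside Λ. Then the following inequality
  holds  L^{d−2} Σ_{c∈Λ′} |(Q₁B)(c)|² + Σ_p |(∂₁B)(p)|² ≥ (1/(12d²)) L^{−d−1} ‖B‖².  (2.128)"*
* [B6] (2.121), p. 244: *"B(b) = 0 for b ⊂ Γ_{y,x}, x ∈ B(y), y ∈ Λ′."*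
* [B6] (2.125), p. 245, first equality: *"|(Q₁B)(c)|² = |Σ_{x∈B(c₋)} L^{−(d+1)} B([x, x + Le_μ])|²"*
  (c = ⟨y, y + Le_μ⟩, c₋ = y, c₊ = y + Le_μ, p. 244).
* [B5] (1.18), p. 20: *"(Q_kA)_b = Σ_{x∈B^k(b₋)} η^{d+1} A([x, x(b)]), b ⊂ T_1^{(k)} = Z^d ∩ T_η, η = L^{−k}, and x(b) is
  a point in B^k(b₊) obtained from x by translation by b."*; (1.11), p. 19: *"(QA)_c = Σ_{x∈B(c₋)} L^{−(d+1)}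
  A([x, x(c)])"*; (1.8), p. 19: *"B_c = Σ_{x∈B(c₋)} L^{−(d+1)} (A(Γ_{c₋,x}) + A([x, x(c)]) + A(Γ_{x(c),c₊})),
  c = ⟨c₋, c₊⟩ ⊂ T_L^{(1)}, where A(Γ) = Σ_{b⊂Γ} A_b for arbitrary contour Γ, and x(c) denotes a point in the block
  B(c₊) obtained by translation of x by the bond c, so if c = ⟨y, y + Le_μ⟩ then x(c) = x + Le_μ."*; p. 18: *"We
  assume that A_b is defined for bonds b with arbitrary orientation and that A_{⟨x,x′⟩} = −A_{⟨x′,x⟩}"*, *"We consider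
  Γ_{y,x}, and all other contours appearing in the paper, as oriented contours, with initial point y and final point
  x."*; the axial gauge, p. 19: *"Axial (Ax) gauge fixing conditions A(Γ_{y,x}) = 0, x ∈ B(y), x ≠ y, y ∈ T_L^{(1)}"*.

## What this file proves

`B6Lemma24Assembly.lemma24_kappa0` is Lemma 2.4 with the constant κ₀/(12d²) (κ₀ = `B6LayerPoincare.kappa0 d L`
= 1/(4 + 6d(L−1)L^{d−2}), replacing the printed 1/(12d²): the printed layer step is refuted for L ≥ 10,
`B6.claim_p245_fails_L10` / `B6.ineq2127_fails_L10`) for the concrete carrier of `B6Lemma24Carrier`, whose Q₁-term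
`q1Of` and gauge condition were typed in tree vocabulary.  This file removes the remaining dictionary steps:

* §1 `q1` — (Q₁B)(c) typed VERBATIM from (2.125)/(1.18)/(1.11): Σ_{x∈B(c₋)} L^{−(d+1)} B([x, x + Le_μ]) with
  B([x, x + Le_μ]) = Σ_{s=0}^{L−1} B(⟨x + se_μ, x + (s+1)e_μ⟩) (`segSum`); `q1_sq : (q1 L B c)² = q1Term L B c` and
  `q1Of_eq : q1Of L Λ′ B = Σ_{c} (q1 L B c)²` — the carrier's Q₁-term IS Σ_{c∈Λ′}|(Q₁B)(c)|².
* §2 `q18` — the three-contour average of B5 (1.8), Σ_{x∈B(c₋)} L^{−(d+1)} (B(Γ_{c₋,x}) + B([x, x(c)]) +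
  B(Γ_{x(c),c₊})), READING Γ_{x(c),c₊} as the contour Γ_{c₊,x(c)} of (1.7) traversed from x(c) to c₊, so that by the
  orientation convention B(Γ_{x(c),c₊}) = −B(Γ_{c₊,x(c)}) (`contourSum`); `q18_eq_q1`: under the hypotheses of Lemma
  2.4 (B = 0 outside Λ, (2.121) in Λ) both averages COINCIDE at every coarse bond c meeting Λ′ ("both points of view",
  B5 p. 19) — inside Λ by (2.121), outside Λ because the contours consist of bonds inside a block disjoint from Λ.
* §3 the printed sums: for B = 0 outside Λ, Σ_{b∈E} |B(b)|² = ‖B‖² (`normSq`) for EVERY finite bond set E ⊇ Λ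
  (`sum_sq_superset`), and Σ_{p∈P} |(∂₁B)(p)|² = `d1Sq` for EVERY finite set P ⊇ `lamPlaq` of plaquettes recorded once
  (directions ordered) (`sum_curlSq_superset`, by `B6Lemma24Carrier.curl_eq_zero_off`); (2.121) in the printed contour
  form implies the tree form used by the carrier (`treeGauge_of_contour`, = `B6BondElimination.axial_iff`).
* §4 **`lemma24_printedShape`**: for d ≥ 2, L ≥ 1, Λ′ ⊂ LZ^d finite, B : bonds(Z^d) → ℝ with B = 0 outside Λ and
  B(Γ_{y,x}) = 0 (x ∈ B(y), y ∈ Λ′), every finite E ⊇ Λ-bonds and every finite plaquette set P ⊇ `lamPlaq`: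
  (κ₀/(12d²)) L^{−d−1} Σ_{b∈E}|B(b)|² ≤ L^{d−2} Σ_{c∈Λ′} |(Q₁B)(c)|² + Σ_{p∈P} |(∂₁B)(p)|², Q₁ as printed;
  `lemma24_printedShape18`: the same with the (1.8) three-contour average.

## HONEST SCOPE

(i) The constant is κ₀/(12d²), not the printed 1/(12d²) (whose printed DERIVATION fails for L ≥ 10 — the layer
sentence and (2.127): `B6.claim_p245_fails_L10`, `B6.ineq2127_fails_L10`, census G-B6-09/09R — while the printed
constant itself is numerically supported but unproved, census G-B6-09R; DOCFIX v1.1 of the v1 wording "false as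
printed for L ≥ 10") and not the repaired κ_L/(12d²) of `B6.Lemma24Repaired` (κ_L = min{1, 4L sin²(π/2L)}); downstream ((2.153), B9 p. 428, B12 (1.7)–(1.9))
only a positive constant γ′₀(d, L) is used (census G-r2.9).  (ii) The ambient lattice is Z^d with Λ′ ⊂ LZ^d finite
(the paper's T is a large torus; with B = 0 outside Λ only the L-neighbourhood of Λ matters).  (iii) "Σ_p" is read
as the sum over plaquettes recorded once with ordered directions (|(∂₁B)(p)|² does not depend on the orientation);
"c ∈ Λ′" for coarse bonds is read, as the lemma says for unit bonds, as "at least one end-point in Λ′"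
(`coarseBonds`, `mem_coarseBonds`).  (iv) The reading of Γ_{x(c),c₊} in (1.8) as the reversed (1.7)-contour is the
only interpretation step of §2; §1/§4 do not depend on it.  Nothing printed is asserted as an axiom: every
hypothesis of §4 is one of the lemma's own printed hypotheses.
-/

open Finset

namespace Literature.MathematicalPhysics.QuantumFieldTheory.Balaban1983to89.B6Lemma24PrintedShape

open B6Elimination (block mem_block)
open B6BondElimination (unitVec unitVec_apply add_unitVec_apply add_smul_unitVec_apply sub_smul_unitVec_apply
  contour mem_contour treeBonds mem_treeBonds contour_subset_treeBonds axial_iff)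
open B6TreeGaugePoincare (Cfg curl innerBonds mem_innerBonds treeBonds_subset_innerBonds)
open B6LayerPoincare (kappa0)
open B6Lemma24Carrier (lam mem_lam lamBonds mem_lamBonds lamPlaqBase lamPlaq mem_lamPlaq curl_eq_zero_off
  normSq d1Sq coarseBonds q1Term q1Of)
open B6Lemma24Assembly (mem_coarseBonds dvd_of_mem_coarseBonds innerBonds_not_mem_lamBonds lemma24_kappa0)

noncomputable section

variable {d : ℕ} {L : ℕ}

/-! ## §1  (Q₁B)(c) as printed: (2.125) / B5 (1.18), (1.11) -/

/-- B([x, x + Le_μ]) = Σ_{s=0}^{L−1} B(⟨x + se_μ, x + (s+1)e_μ⟩): *"A(Γ) = Σ_{b⊂Γ} A_b for arbitrary contour Γ"* applied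
to the straight contour [x, x(c)], x(c) = x + Le_μ. [cite: Balaban1984PropagatorsI, (1.8)/(1.11) p.19] -/
def segSum (L : ℕ) (B : Cfg d) (x : Fin d → ℤ) (μ : Fin d) : ℝ :=
  ∑ s ∈ range L, B (x + (s : ℤ) • unitVec μ, μ)

/-- **(Q₁B)(c), verbatim** ((2.125) first equality = B5 (1.18) with k = 1 = B5 (1.11)):
(Q₁B)(c) = Σ_{x∈B(c₋)} L^{−(d+1)} B([x, x + Le_μ]), c = ⟨y, y + Le_μ⟩ recorded as (y, μ).
[cite: Balaban1984PropagatorsII, (2.125) p.245] -/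
def q1 (L : ℕ) (B : Cfg d) (c : (Fin d → ℤ) × Fin d) : ℝ :=
  ∑ x ∈ block L c.1, ((L : ℝ) ^ (d + 1))⁻¹ * segSum L B x c.2

/-- |(Q₁B)(c)|² is the carrier's Q₁-term `q1Term` (typed in `B6Lemma24Carrier` from the same display (2.125)).
[cite: Balaban1984PropagatorsII, (2.125) p.245] -/
theorem q1_sq (B : Cfg d) (c : (Fin d → ℤ) × Fin d) : q1 L B c ^ 2 = q1Term L B c := by
  simp only [q1, segSum, q1Term, inv_pow]

/-- Σ_{c∈Λ′} |(Q₁B)(c)|² (c ranging over the coarse bonds with an end-point in Λ′) is the carrier's `q1Of`.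
[cite: Balaban1984PropagatorsII, (2.128) p.245] -/
theorem q1Of_eq (Λ' : Finset (Fin d → ℤ)) (B : Cfg d) :
    q1Of L Λ' B = ∑ c ∈ coarseBonds L Λ', q1 L B c ^ 2 := by
  simp only [q1Of, q1_sq]

/-! ## §2  The three-contour average of B5 (1.8) coincides with Q₁ under the hypotheses of Lemma 2.4 -/

/-- B(Γ_{y,x}) = Σ_{b⊂Γ_{y,x}} B(b), the (1.7)-contour from y to x traversed positively (all its unit bonds point in
positive coordinate directions). [cite: Balaban1984PropagatorsI, (1.7)–(1.8) p.18–19] -/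
def contourSum (L : ℕ) (B : Cfg d) (y x : Fin d → ℤ) : ℝ :=
  ∑ b ∈ contour L y x, B b

/-- **B_c of B5 (1.8)** (three-contour average): Σ_{x∈B(c₋)} L^{−(d+1)} (B(Γ_{c₋,x}) + B([x, x(c)]) + B(Γ_{x(c),c₊})),
x(c) = x + Le_μ, with B(Γ_{x(c),c₊}) = −B(Γ_{c₊,x(c)}) (READING: Γ_{x(c),c₊} is the (1.7)-contour Γ_{c₊,x(c)} run from
x(c) to c₊; *"A_{⟨x,x′⟩} = −A_{⟨x′,x⟩}"*, p. 18). [cite: Balaban1984PropagatorsI, (1.8) p.19] -/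
def q18 (L : ℕ) (B : Cfg d) (c : (Fin d → ℤ) × Fin d) : ℝ :=
  ∑ x ∈ block L c.1, ((L : ℝ) ^ (d + 1))⁻¹ *
    (contourSum L B c.1 x + segSum L B x c.2
      + -contourSum L B (c.1 + (L : ℤ) • unitVec c.2) (x + (L : ℤ) • unitVec c.2))

/-- x ∈ B(y) ⇒ x(c) = x + Le_μ ∈ B(y + Le_μ) = B(c₊). [cite: Balaban1984PropagatorsI, (1.8) p.19] -/
theorem add_smul_mem_block {y x : Fin d → ℤ} (hx : x ∈ block L y) (μ : Fin d) :
    x + (L : ℤ) • unitVec μ ∈ block L (y + (L : ℤ) • unitVec μ) := by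
  refine mem_block.2 fun i => ?_
  have hi := mem_block.1 hx i
  rw [add_smul_unitVec_apply, add_smul_unitVec_apply]
  split_ifs <;> omega

/-- The two averages agree at c as soon as the contours of B(c₋) and of B(c₊) carry B-sum zero.
[cite: Balaban1984PropagatorsI, (1.8), (1.11) p.19] -/
theorem q18_eq_q1_of_contours {B : Cfg d} {c : (Fin d → ℤ) × Fin d}
    (hm : ∀ x ∈ block L c.1, contourSum L B c.1 x = 0)
    (hp : ∀ x' ∈ block L (c.1 + (L : ℤ) • unitVec c.2), contourSum L B (c.1 + (L : ℤ) • unitVec c.2) x' = 0) :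
    q18 L B c = q1 L B c := by
  unfold q18 q1
  refine sum_congr rfl fun x hx => ?_
  rw [hm x hx, hp _ (add_smul_mem_block hx c.2)]
  ring

/-- Under the hypotheses of Lemma 2.4 the contour sums of every block B(y), y ∈ LZ^d, vanish: for y ∈ Λ′ by (2.121)
(tree form), for y ∉ Λ′ because B = 0 outside Λ and Γ_{y,x} ⊂ B(y) is disjoint from Λ. [folklore] -/
theorem contourSum_eq_zero (hL : 0 < L) {Λ' : Finset (Fin d → ℤ)} (hΛ : ∀ y ∈ Λ', ∀ i, (L : ℤ) ∣ y i)
    {B : Cfg d} (hB0 : ∀ b, b ∉ lamBonds L Λ' → B b = 0) (hT : ∀ y ∈ Λ', ∀ b ∈ treeBonds L y, B b = 0)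
    {y : Fin d → ℤ} (hy : ∀ i, (L : ℤ) ∣ y i) {x : Fin d → ℤ} (hx : x ∈ block L y) :
    contourSum L B y x = 0 := by
  refine sum_eq_zero fun b hb => ?_
  have hbt := contour_subset_treeBonds hx hb
  by_cases hyΛ : y ∈ Λ'
  · exact hT y hyΛ b hbt
  · exact hB0 b (innerBonds_not_mem_lamBonds hL hΛ hyΛ hy (treeBonds_subset_innerBonds y hbt))

/-- **"Both points of view" agree here**: under the hypotheses of Lemma 2.4 (Λ′ ⊂ LZ^d, B = 0 outside Λ, (2.121) in
the blocks of Λ) the (1.8) three-contour average and the (2.125)/(1.11) straight average coincide at every coarse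
bond c meeting Λ′. [cite: Balaban1984PropagatorsI, (1.8), (1.11) p.19] -/
theorem q18_eq_q1 (hL : 0 < L) {Λ' : Finset (Fin d → ℤ)} (hΛ : ∀ y ∈ Λ', ∀ i, (L : ℤ) ∣ y i) {B : Cfg d}
    (hB0 : ∀ b, b ∉ lamBonds L Λ' → B b = 0) (hT : ∀ y ∈ Λ', ∀ b ∈ treeBonds L y, B b = 0)
    {c : (Fin d → ℤ) × Fin d} (hc : c ∈ coarseBonds L Λ') : q18 L B c = q1 L B c := by
  have hcd := dvd_of_mem_coarseBonds hΛ hc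
  have hcd' : ∀ i, (L : ℤ) ∣ (c.1 + (L : ℤ) • unitVec c.2) i := fun i => by
    rw [add_smul_unitVec_apply]
    exact dvd_add (hcd i) (by split_ifs <;> simp)
  exact q18_eq_q1_of_contours (fun x hx => contourSum_eq_zero hL hΛ hB0 hT hcd hx)
    fun x' hx' => contourSum_eq_zero hL hΛ hB0 hT hcd' hx'

/-! ## §3  The printed sums ‖B‖², Σ_p over all bonds / plaquettes; (2.121) printed ⇒ tree form -/

/-- **B = 0 outside Λ**: ‖B‖² summed over ANY finite set of bonds containing the bonds of Λ equals `normSq`.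
[cite: Balaban1984PropagatorsII, Lemma 2.4 p.245 "We put B = 0 outside Λ"] -/
theorem sum_sq_superset {Λ' : Finset (Fin d → ℤ)} {B : Cfg d} (hB0 : ∀ b, b ∉ lamBonds L Λ' → B b = 0)
    {E : Finset ((Fin d → ℤ) × Fin d)} (hE : lamBonds L Λ' ⊆ E) : ∑ b ∈ E, B b ^ 2 = normSq L Λ' B := by
  rw [normSq]
  refine (sum_subset hE fun b _ hb => ?_).symm
  rw [hB0 b hb]
  ring

/-- **B = 0 outside Λ**: Σ_p |(∂₁B)(p)|² over ANY finite set of once-recorded plaquettes (lowest corner z, directions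
j < μ) containing `lamPlaq` equals `d1Sq` — far plaquettes are flat (`curl_eq_zero_off`).
[cite: Balaban1984PropagatorsII, (2.128) p.245] -/
theorem sum_curlSq_superset {Λ' : Finset (Fin d → ℤ)} {B : Cfg d} (hB0 : ∀ b, b ∉ lamBonds L Λ' → B b = 0)
    {P : Finset ((Fin d → ℤ) × Fin d × Fin d)} (hP : lamPlaq L Λ' ⊆ P) (hPo : ∀ p ∈ P, p.2.1 < p.2.2) :
    ∑ p ∈ P, curl B p.1 p.2.1 p.2.2 ^ 2 = d1Sq L Λ' B := by
  rw [d1Sq]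
  refine (sum_subset hP fun p hpP hp => ?_).symm
  have hlt := hPo p hpP
  have hz : p.1 ∉ lamPlaqBase L Λ' := fun h => hp (mem_lamPlaq.2 ⟨h, hlt⟩)
  rw [curl_eq_zero_off hB0 (ne_of_lt hlt) hz]
  ring

/-- Without the once-recorded proviso the printed plaquette sum can only be larger. [folklore] -/
theorem d1Sq_le_sum_superset (Λ' : Finset (Fin d → ℤ)) (B : Cfg d)
    {P : Finset ((Fin d → ℤ) × Fin d × Fin d)} (hP : lamPlaq L Λ' ⊆ P) :
    d1Sq L Λ' B ≤ ∑ p ∈ P, curl B p.1 p.2.1 p.2.2 ^ 2 := by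
  rw [d1Sq]
  exact sum_le_sum_of_subset_of_nonneg hP fun _ _ _ => sq_nonneg _

/-- **(2.121) as printed ⇒ the tree form** used by the carrier: "B(Γ_{y,x}) = 0 for x ∈ B(y)" (contour sums) gives
B(b) = 0 for every bond b of the tree Γ_y = ⋃_x Γ_{y,x} (`B6BondElimination.axial_iff`).
[cite: Balaban1984PropagatorsII, (2.121) p.244] -/
theorem treeGauge_of_contour {B : Cfg d} {y : Fin d → ℤ} (h : ∀ x ∈ block L y, contourSum L B y x = 0) :
    ∀ b ∈ treeBonds L y, B b = 0 :=
  (axial_iff y B).1 fun x hx _ => h x hx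

/-- Conversely the bondwise form of (2.121), "B(b) = 0 for b ⊂ Γ_{y,x}", gives the contour sums.
[cite: Balaban1984PropagatorsII, (2.121) p.244] -/
theorem contourSum_eq_zero_of_bondwise {B : Cfg d} {y : Fin d → ℤ}
    (h : ∀ x ∈ block L y, ∀ b ∈ contour L y x, B b = 0) : ∀ x ∈ block L y, contourSum L B y x = 0 :=
  fun x hx => sum_eq_zero fun b hb => h x hx b hb

/-! ## §4  Lemma 2.4 (2.128)_κ₀ in the printed shape -/

/-- **Lemma 2.4 with the constant κ₀/(12d²), printed shape.**  Let d ≥ 2, L ≥ 1, Λ′ ⊂ LZ^d finite, Λ = ⋃_{y∈Λ′}B(y);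
let B be a bond configuration on Z^d with B = 0 outside Λ (i.e. on every bond with no end-point in Λ) satisfying
(2.121): B(Γ_{y,x}) = 0 for x ∈ B(y), y ∈ Λ′.  Then for every finite set E of bonds containing the bonds of Λ and
every finite set P of plaquettes containing `lamPlaq L Λ′`:
(κ₀/(12d²)) L^{−d−1} Σ_{b∈E} |B(b)|² ≤ L^{d−2} Σ_{c∈Λ′} |(Q₁B)(c)|² + Σ_{p∈P} |(∂₁B)(p)|²,
with (Q₁B)(c) = Σ_{x∈B(c₋)} L^{−(d+1)} B([x, x + Le_μ]) as printed ((2.125)/(1.18)) and c ranging over the coarse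
bonds with an end-point in Λ′.  κ₀ = 1/(4 + 6d(L−1)L^{d−2}) replaces the printed 1 (whose printed derivation
is refuted for L ≥ 10; the printed constant itself is unproved). [cite: Balaban1984PropagatorsII, Lemma 2.4 (2.128) p.245] -/
theorem lemma24_printedShape (hd : 2 ≤ d) (hL : 1 ≤ L) {Λ' : Finset (Fin d → ℤ)}
    (hΛ : ∀ y ∈ Λ', ∀ i, (L : ℤ) ∣ y i) (B : Cfg d) (hB0 : ∀ b, b ∉ lamBonds L Λ' → B b = 0)
    (h2121 : ∀ y ∈ Λ', ∀ x ∈ block L y, contourSum L B y x = 0)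
    {E : Finset ((Fin d → ℤ) × Fin d)} (hE : lamBonds L Λ' ⊆ E)
    {P : Finset ((Fin d → ℤ) × Fin d × Fin d)} (hP : lamPlaq L Λ' ⊆ P) :
    kappa0 d L / (12 * (d : ℝ) ^ 2) * (L : ℝ) ^ (-((d : ℝ) + 1)) * ∑ b ∈ E, B b ^ 2 ≤
      (L : ℝ) ^ ((d : ℝ) - 2) * ∑ c ∈ coarseBonds L Λ', q1 L B c ^ 2
        + ∑ p ∈ P, curl B p.1 p.2.1 p.2.2 ^ 2 := by
  have h := lemma24_kappa0 hd hL hΛ B hB0 fun y hy => treeGauge_of_contour (h2121 y hy)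
  rw [sum_sq_superset hB0 hE, ← q1Of_eq]
  exact h.trans (add_le_add_right (d1Sq_le_sum_superset Λ' B hP) _)

/-- The same with (2.121) in its bondwise printed form "B(b) = 0 for b ⊂ Γ_{y,x}, x ∈ B(y), y ∈ Λ′" (p. 244).
[cite: Balaban1984PropagatorsII, (2.121) p.244, (2.128) p.245] -/
theorem lemma24_printedShape_bondwise (hd : 2 ≤ d) (hL : 1 ≤ L) {Λ' : Finset (Fin d → ℤ)}
    (hΛ : ∀ y ∈ Λ', ∀ i, (L : ℤ) ∣ y i) (B : Cfg d) (hB0 : ∀ b, b ∉ lamBonds L Λ' → B b = 0)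
    (h2121 : ∀ y ∈ Λ', ∀ x ∈ block L y, ∀ b ∈ contour L y x, B b = 0)
    {E : Finset ((Fin d → ℤ) × Fin d)} (hE : lamBonds L Λ' ⊆ E)
    {P : Finset ((Fin d → ℤ) × Fin d × Fin d)} (hP : lamPlaq L Λ' ⊆ P) :
    kappa0 d L / (12 * (d : ℝ) ^ 2) * (L : ℝ) ^ (-((d : ℝ) + 1)) * ∑ b ∈ E, B b ^ 2 ≤
      (L : ℝ) ^ ((d : ℝ) - 2) * ∑ c ∈ coarseBonds L Λ', q1 L B c ^ 2
        + ∑ p ∈ P, curl B p.1 p.2.1 p.2.2 ^ 2 :=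
  lemma24_printedShape hd hL hΛ B hB0 (fun y hy => contourSum_eq_zero_of_bondwise (h2121 y hy)) hE hP

/-- **Lemma 2.4 (2.128)_κ₀ with the B5 (1.8) three-contour average** in place of Q₁ (they coincide under the
hypotheses, `q18_eq_q1`). [cite: Balaban1984PropagatorsII, Lemma 2.4 (2.128) p.245]
[cite: Balaban1984PropagatorsI, (1.8) p.19] -/
theorem lemma24_printedShape18 (hd : 2 ≤ d) (hL : 1 ≤ L) {Λ' : Finset (Fin d → ℤ)}
    (hΛ : ∀ y ∈ Λ', ∀ i, (L : ℤ) ∣ y i) (B : Cfg d) (hB0 : ∀ b, b ∉ lamBonds L Λ' → B b = 0)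
    (h2121 : ∀ y ∈ Λ', ∀ x ∈ block L y, contourSum L B y x = 0)
    {E : Finset ((Fin d → ℤ) × Fin d)} (hE : lamBonds L Λ' ⊆ E)
    {P : Finset ((Fin d → ℤ) × Fin d × Fin d)} (hP : lamPlaq L Λ' ⊆ P) :
    kappa0 d L / (12 * (d : ℝ) ^ 2) * (L : ℝ) ^ (-((d : ℝ) + 1)) * ∑ b ∈ E, B b ^ 2 ≤
      (L : ℝ) ^ ((d : ℝ) - 2) * ∑ c ∈ coarseBonds L Λ', q18 L B c ^ 2
        + ∑ p ∈ P, curl B p.1 p.2.1 p.2.2 ^ 2 := by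
  have hL0 : 0 < L := Nat.lt_of_lt_of_le Nat.zero_lt_one hL
  have hT : ∀ y ∈ Λ', ∀ b ∈ treeBonds L y, B b = 0 := fun y hy => treeGauge_of_contour (h2121 y hy)
  have e : ∑ c ∈ coarseBonds L Λ', q18 L B c ^ 2 = ∑ c ∈ coarseBonds L Λ', q1 L B c ^ 2 :=
    sum_congr rfl fun c hc => by rw [q18_eq_q1 hL0 hΛ hB0 hT hc]
  rw [e]
  exact lemma24_printedShape hd hL hΛ B hB0 h2121 hE hP

/-- With once-recorded plaquettes (directions ordered) the plaquette sum is literally the printed Σ_p over all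
plaquettes carrying (∂₁B) ≠ 0, and the inequality reads with `=`-normalised sums:
(κ₀/(12d²)) L^{−d−1} ‖B‖² ≤ L^{d−2} Σ_{c∈Λ′}|(Q₁B)(c)|² + Σ_p|(∂₁B)(p)|² where ‖B‖² = `normSq`, Σ_p = `d1Sq`
are independent of the finite carriers E ⊇ Λ-bonds, P ⊇ `lamPlaq` chosen. [cite: Balaban1984PropagatorsII, (2.128) p.245] -/
theorem lemma24_printedShape_eq (hd : 2 ≤ d) (hL : 1 ≤ L) {Λ' : Finset (Fin d → ℤ)}
    (hΛ : ∀ y ∈ Λ', ∀ i, (L : ℤ) ∣ y i) (B : Cfg d) (hB0 : ∀ b, b ∉ lamBonds L Λ' → B b = 0)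
    (h2121 : ∀ y ∈ Λ', ∀ x ∈ block L y, contourSum L B y x = 0)
    {E : Finset ((Fin d → ℤ) × Fin d)} (hE : lamBonds L Λ' ⊆ E)
    {P : Finset ((Fin d → ℤ) × Fin d × Fin d)} (hP : lamPlaq L Λ' ⊆ P) (hPo : ∀ p ∈ P, p.2.1 < p.2.2) :
    ∑ b ∈ E, B b ^ 2 = normSq L Λ' B ∧ ∑ p ∈ P, curl B p.1 p.2.1 p.2.2 ^ 2 = d1Sq L Λ' B ∧
    kappa0 d L / (12 * (d : ℝ) ^ 2) * (L : ℝ) ^ (-((d : ℝ) + 1)) * normSq L Λ' B ≤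
      (L : ℝ) ^ ((d : ℝ) - 2) * ∑ c ∈ coarseBonds L Λ', q1 L B c ^ 2 + d1Sq L Λ' B := by
  refine ⟨sum_sq_superset hB0 hE, sum_curlSq_superset hB0 hP hPo, ?_⟩
  rw [← q1Of_eq]
  exact lemma24_kappa0 hd hL hΛ B hB0 fun y hy => treeGauge_of_contour (h2121 y hy)

end

end Literature.MathematicalPhysics.QuantumFieldTheory.Balaban1983to89.B6Lemma24PrintedShape
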